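import Literature.NumberTheory.EllipticCurves.AnticyclotomicPrimeDecompositionSplitProofs
import Literature.NumberTheory.EllipticCurves.Agboola2007.RestrictedSelmerGroups
import Literature.NumberTheory.GaloisRepresentations.IdelicLocalNorm
import HarnessLib

/-!
# Crux `PrintCf2.SplitBadTwoRankOneOfFacts` (stmt-BirchSwinnertonDyer-20368), road α v10.3 — the class-field-theoretic input (C1) PROVED:
# **no finite place `w ≠ v̄` of an imaginary quadratic `K` splits completely in a `ℤ_p`-line unramified outside a split prime `v̄ ∣ p`**

Cell `bsd-print-cf2`, width seat `bsd-line-cf2-p1-w3` g8 (prover-bsd-line-cf2-p1-w3-g8-0). `--supports stmt-BirchSwinnertonDyer-20368`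
(helper, Theses-free). HONEST FRAMING: nothing here closes the crux or a registered stub; BSD is not proved by any of this; no summit
statement is proved by this seat. No definition, no named fact, no `sorry`.

WHY. The exact local kernels of the control of `𝔖_{v̄}(K*_∞, W*)` (B16-EXACT p662395, B16-TAM p663318/p664173, -w2 g9's B15 memo §1 (C1))
carry the displayed hypothesis `¬ decomp w ≤ κ'.kerSubgroup` («`w` does not split completely in `K*_∞`»), listed in the memo as «class
field theory, NOT in the tree». It IS provable in the tree, which has PROVED global class field theory in idelic form and the `ℤ_p`-valued
idelic character of a `ℤ_p`-extension (`ZpExtension.exists_idelicCharacter` etc., the discharge files of Brink 2007 Thm. 2 — the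
anticyclotomic analogue); this file runs the idelic computation for the `v̄`-ADIC line.
WHAT. `K` imaginary quadratic, `v ≠ v̄` two places above `p`, `κ` a `ℤ_p`-extension unramified outside `v̄` (`ZpExtension.IsUnramifiedOutside`),
`w ≠ v̄` ANY finite place: **`decomp_not_le_kerSubgroup_of_isUnramifiedOutside : ¬ GreenbergSelmer.decomp w ≤ κ.kerSubgroup`**.
PROOF. `Λ = κ^ab ∘ [·, K] : 𝕀_K → ℤ_p`. (§2) `Λ` kills the local units at every `u ≠ v̄`: at `u ∤ p` by Washington 13.2 (tree); at `u ∣ p`,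
`u ≠ v̄` because `I_u ≤ ker κ` and the local symbol `Λ(⟨a_u w⟩_u) = κ(res_u w)⁻¹` with `a_u(I) = 𝒪_uˣ` (`IsLocalArtinMap.image_inertia`).
(§3) If `D_w ≤ ker κ` then `Λ(⟨K_wˣ⟩) = 1`; with `𝔭_w^h = (β)` the product formula for the principal idele `β` leaves `Λ(⟨β⟩_{v̄}) = 1`. The element
`y = (⟨cβ⟩_v, ⟨β⟩_{v̄})` of `U_p = 𝒪_vˣ × 𝒪_{v̄}ˣ` (`c` the non-trivial automorphism, `c v̄ = v`) is then killed by `Λ` AND by `a ↦ Λ(c • a)` (it is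
`c`-invariant); these two characters of `U_p ⊇ W ≅ ℤ_p²` (tree `PRamified.exists_openSubgroup_localUnits_equiv_holds`) are `ℤ_p`-independent (a
combination killing `U_p` would make `Λ` kill ALL local units above `p`, against `exists_idelicCharacter_localUnits_ne_one`), so
`y^{[U_p:W]} = 1` (`pow_index_eq_one_of_apply_eq_one`), i.e. `β^m = 1` — absurd, `(β) = 𝔭_w^h ≠ (1)`.
§1 quadratic fields (`eq_one_or_eq_of_finrank_eq_two`, `eq_or_eq_smul_of_natCast_mem`); §2 `idelicCharacter_localUnits_eq_one_of_inertia_le` (+ `unitsMap` form); §3 the theorem.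
presearch: Brink 2007 Thm. 2 / Cor. 1 (held), Lang 1990 Ch. 5 §5, de Shalit 1987 II §1.1 (primes `𝔮 ∤ 𝔭` are finitely decomposed in
`K(𝔭^∞)`), Washington §13 — held; tree: the Brink discharge files reused BY NAME; no fact filed. beyond-print theorem: no (standard CFT).

References: [Brink2007] §II Prop. 1, Thm. 2; [Lang1990] Ch. 5 §5; [deShalit1987] II §1.1; [NeukirchANT1999] VI (5.6), VII (6.13);
[CasselsFrohlichANT1967] VII §1.1, §4.2, §6; [Washington1997] §13.1–13.2.
-/

noncomputable section

open Field NumberField IsDedekindDomain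
open scoped Pointwise

set_option linter.dupNamespace false
set_option autoImplicit false

namespace Summit.BirchSwinnertonDyer.BirchSwinnertonDyer.Theorems.PrintCf2.LineDecomposition

open Literature.NumberTheory.GaloisRepresentations Literature.NumberTheory.NumberFields
open Literature.NumberTheory.Automorphic Literature.NumberTheory.EllipticCurves
open Literature.NumberTheory.EllipticCurves.PRamified Literature.NumberTheory.EllipticCurves.ZpExtension

/-! ## §1. Quadratic fields: the non-trivial automorphism and the places above a split prime -/

section Quadratic
variable {K : Type} [Field K] [NumberField K]
/-- Every automorphism of a quadratic field is `1` or the non-trivial one `c` (`#Gal(K/ℚ) = 2`). [folklore] -/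
theorem eq_one_or_eq_of_finrank_eq_two (hK2 : Module.finrank ℚ K = 2) {c : K ≃ₐ[ℚ] K} (hc : c ≠ 1)
    (σ : K ≃ₐ[ℚ] K) : σ = 1 ∨ σ = c := by
  classical
  haveI : Algebra.IsQuadraticExtension ℚ K := ⟨hK2⟩
  have hcard : Fintype.card (K ≃ₐ[ℚ] K) = 2 := by rw [← Nat.card_eq_fintype_card, IsGalois.card_aut_eq_finrank, hK2]
  by_contra h
  rw [not_or] at h
  have hlt : 2 < Fintype.card (K ≃ₐ[ℚ] K) := by
    rw [← Finset.card_univ]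
    exact Finset.two_lt_card_iff.mpr ⟨1, c, σ, Finset.mem_univ _, Finset.mem_univ _,
      Finset.mem_univ _, hc.symm, fun h1 ↦ h.1 h1.symm, fun h2 ↦ h.2 h2.symm⟩
  rw [hcard] at hlt
  exact lt_irrefl _ hlt

/-- **In a quadratic field, a place above a prime with two distinct places `v ≠ v̄` above it is `v̄` or `c • v̄ = v`**: for `c ≠ 1`,
`c • v̄ = v`, `c • v = v̄`, and every `u ∋ p` is `v` or `v̄` (transitivity of `Gal(K/ℚ)` on the places above `p`).
[cite: CasselsFrohlichANT1967, Ch. VII Prop. 1.2 (ii)] -/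
theorem eq_or_eq_smul_of_natCast_mem (hK2 : Module.finrank ℚ K = 2) {c : K ≃ₐ[ℚ] K} (hc : c ≠ 1) {p : ℕ} (hp : p.Prime)
    {v vbar : HeightOneSpectrum (𝓞 K)} (hv : ((p : ℕ) : 𝓞 K) ∈ v.asIdeal) (hvbar : ((p : ℕ) : 𝓞 K) ∈ vbar.asIdeal)
    (hne : vbar ≠ v) :
    c * c = 1 ∧ c • vbar = v ∧ c • v = vbar ∧
      ∀ u : HeightOneSpectrum (𝓞 K), ((p : ℕ) : 𝓞 K) ∈ u.asIdeal → u = v ∨ u = vbar := by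
  haveI : Algebra.IsQuadraticExtension ℚ K := ⟨hK2⟩
  haveI : IsGalois ℚ K := inferInstance
  -- `c` is an involution (`c² ∈ {1, c}` and `c ≠ 1`; tree `QuadraticRamification.algEquiv_mul_self_eq_one_of_finrank_eq_two`)
  have hcc : c * c = 1 := (eq_one_or_eq_of_finrank_eq_two hK2 hc (c * c)).elim id
    fun h ↦ absurd (mul_left_cancel (h.trans (mul_one c).symm)) hc
  -- two places containing `p` lie over the same place of `ℚ` (tree `KatzLineFrame.under_rat_eq_of_natCast_mem`)
  have hunder : ∀ u : HeightOneSpectrum (𝓞 K), ((p : ℕ) : 𝓞 K) ∈ u.asIdeal → u.under (𝓞 ℚ) = v.under (𝓞 ℚ) := by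
    have key : ∀ u : HeightOneSpectrum (𝓞 K), ((p : ℕ) : 𝓞 K) ∈ u.asIdeal →
        Rat.HeightOneSpectrum.natGenerator (u.under (𝓞 ℚ)) = p := by
      intro u hu
      have hmem : ((p : ℕ) : 𝓞 ℚ) ∈ (u.under (𝓞 ℚ)).asIdeal := by
        change algebraMap (𝓞 ℚ) (𝓞 K) ((p : ℕ) : 𝓞 ℚ) ∈ u.asIdeal
        rwa [map_natCast]
      exact (Nat.prime_dvd_prime_iff_eq (Rat.HeightOneSpectrum.prime_natGenerator _) hp).mp
        ((Rat.natCast_mem_asIdeal_iff _).mp hmem)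
    intro u hu
    apply (Rat.HeightOneSpectrum.primesEquiv (R := 𝓞 ℚ)).injective
    exact Subtype.ext ((key u hu).trans (key v hv).symm)
  have h1 : c • vbar = v := by
    obtain ⟨σ, hσ⟩ := HeightOneSpectrum.exists_algEquiv_smul_eq (F := ℚ) (hunder vbar hvbar)
    rcases eq_one_or_eq_of_finrank_eq_two hK2 hc σ with rfl | hσc
    · rw [one_smul] at hσ; exact absurd hσ hne
    · rw [hσc] at hσ; exact hσ
  have h2 : c • v = vbar := by rw [← h1, smul_smul, hcc, one_smul]
  refine ⟨hcc, h1, h2, fun u hu ↦ ?_⟩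
  obtain ⟨σ, hσ⟩ := HeightOneSpectrum.exists_algEquiv_smul_eq (F := ℚ) (hunder u hu)
  rcases eq_one_or_eq_of_finrank_eq_two hK2 hc σ with rfl | hσc
  · left; rwa [one_smul] at hσ
  · right
    rw [hσc] at hσ
    have h := congrArg (fun x ↦ c • x) hσ
    simp only [smul_smul, hcc, one_smul] at h
    rw [h, h2]

end Quadratic

/-! ## §2. The idelic character kills the local units at every place unramified in the line -/

section Units
variable {K : Type} [Field K] [NumberField K] {p : ℕ} [Fact p.Prime] (κ : ZpExtension K p)
  {Λ : ideleGroup K →ₜ* Multiplicative ℤ_[p]}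
  (hΛ : ∀ (a : ideleGroup K) (γ : absoluteGaloisGroup K),
    absGaloisAbProj K γ = ideleArtinMap K a → Λ a = κ.toContinuousMonoidHom γ)
include hΛ
/-- **`Λ(⟨𝒪_uˣ⟩) = 1` at a place `u` where the line is unramified (`I_u ≤ ker κ`)**, also above `p`: a local unit `y` is `a_u(i)` for some `i`
in the Weil inertia (`IsLocalArtinMap.image_inertia`), and the local symbol gives `Λ(⟨a_u i⟩_u) = κ(res_u i)⁻¹ = 1` since `res_u i ∈ I_u`.
[cite: NeukirchANT1999, Ch. VI §5 Prop. (5.6)] [cite: CasselsFrohlichANT1967, Ch. VII §4.2 Corollary (iii)] -/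
theorem idelicCharacter_localUnits_eq_one_of_inertia_le {u : HeightOneSpectrum (𝓞 K)}
    (hI : GreenbergSelmer.inertia u ≤ κ.kerSubgroup) (y : (u.adicCompletion K)ˣ)
    (hy : Valued.v (y : u.adicCompletion K) = 1) : Λ (localUnits u y) = 1 := by
  have ha := isLocalArtinMap_canonicalArtin_holds (u.adicCompletion K)
  have hle : ∀ x z : u.adicCompletion K,
      ValuativeRel.valuation (u.adicCompletion K) x ≤ ValuativeRel.valuation (u.adicCompletion K) z ↔ Valued.v x ≤ Valued.v z :=
    fun x z ↦ (Valuation.vle_iff_le (ValuativeRel.valuation (u.adicCompletion K))).symm.trans (Valuation.vle_iff_le Valued.v)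
  have hy' : ValuativeRel.valuation (u.adicCompletion K) (y : u.adicCompletion K) = 1 := by
    refine le_antisymm ?_ ?_ <;>
      rw [← (ValuativeRel.valuation (u.adicCompletion K)).map_one, hle, Valued.v.map_one, hy]
  have hmem : y ∈ (ValuativeRel.valuation (u.adicCompletion K)).valuationSubring.unitGroup := by
    rw [Valuation.mem_unitGroup_iff]; exact hy'
  rw [← ha.image_inertia] at hmem
  obtain ⟨i, hi, rfl⟩ := Subgroup.mem_map.mp hmem
  rw [idelicCharacter_localUnits_canonicalArtin κ hΛ u i, inv_eq_one, ← mem_kerSubgroup]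
  refine hI (Subgroup.mem_map.mpr ⟨WeilGroup.toAbsGalois _ i, WeilGroup.mem_inertia_iff.mp hi, rfl⟩)

/-- The same for a unit `y ∈ 𝒪_uˣ` given as such. [cite: NeukirchANT1999, Ch. VI §5 Prop. (5.6)] -/
theorem idelicCharacter_unitsMap_eq_one_of_inertia_le {u : HeightOneSpectrum (𝓞 K)}
    (hI : GreenbergSelmer.inertia u ≤ κ.kerSubgroup) (y : (u.adicCompletionIntegers K)ˣ) :
    Λ (localUnits u (Units.map ((u.adicCompletionIntegers K).subtype : _ →* _) y)) = 1 :=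
  idelicCharacter_localUnits_eq_one_of_inertia_le κ hΛ hI _
    ((Valuation.Integers.isUnit_iff_valuation_eq_one (Valuation.valuationSubring.integers _)).1 (Units.isUnit y))

end Units

/-! ## §3. No finite place `w ≠ v̄` splits completely in a line unramified outside the split prime `v̄` -/

section Main
variable {K : Type} [Field K] [NumberField K] {p : ℕ} [Fact p.Prime]
/-- **(C1) — NO FINITE PLACE `w ≠ v̄` OF AN IMAGINARY QUADRATIC FIELD SPLITS COMPLETELY IN A `ℤ_p`-LINE UNRAMIFIED OUTSIDE A SPLIT PRIME `v̄`.**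
`K` imaginary quadratic, `v ≠ v̄` two places above `p`, `κ` a `ℤ_p`-extension of `K` unramified outside `v̄`, `w ≠ v̄` a finite place. Then the
decomposition group `D_w` is NOT contained in `Gal(K̄/K_∞)`: `w` is finitely decomposed in `K_∞`. Idelic proof (module docstring): the idelic
character `Λ` of `κ` kills `Kˣ`, `K_∞ˣ`, `𝒪_uˣ` (`u ≠ v̄`) and — if `w` split completely — `K_wˣ`, so with `𝔭_w^h = (β)` it kills `⟨β⟩_{v̄}`; then
`Λ` and `Λ ∘ c` both kill the `c`-invariant local unit `(⟨cβ⟩_v, ⟨β⟩_{v̄}) ∈ U_p ⊇ W ≅ ℤ_p²`, two independent characters, so `β^{[U_p : W]} = 1`: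
absurd. (de Shalit: «every prime of `K` not dividing `𝔭` is finitely decomposed in `K(𝔭^∞)`»; Brink's Thm. 2 is the anticyclotomic analogue.)
[cite: deShalit1987, Ch. II §1.1] [cite: Brink2007, Thm. 2 and §II Prop. 1] [cite: Lang1990, Ch. 5 §5, Thm. 5.1–5.2] -/
theorem decomp_not_le_kerSubgroup_of_isUnramifiedOutside (hK : IsImaginaryQuadratic K)
    {v vbar : HeightOneSpectrum (𝓞 K)} (hv : ((p : ℕ) : 𝓞 K) ∈ v.asIdeal) (hvbar : ((p : ℕ) : 𝓞 K) ∈ vbar.asIdeal)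
    (hne : vbar ≠ v) (κ : ZpExtension K p) (hκ : κ.IsUnramifiedOutside vbar)
    {w : HeightOneSpectrum (𝓞 K)} (hw : w ≠ vbar) :
    ¬ GreenbergSelmer.decomp w ≤ κ.kerSubgroup := by
  intro hD
  classical
  have hp : p.Prime := Fact.out
  haveI : IsTotallyComplex K := hK.2
  haveI : Algebra.IsQuadraticExtension ℚ K := ⟨hK.1⟩
  haveI : IsGalois ℚ K := inferInstance
  obtain ⟨g, hg, -⟩ := exists_not_mem_range_absGaloisRestrict K (Rat.castHom ℝ)
    (fun u ↦ IsTotallyComplex.isComplex u)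
  set c : K ≃ₐ[ℚ] K := absGaloisQuot ℚ K g with hcdef
  have hc : c ≠ 1 := fun h1 ↦ hg ((absGaloisQuot_eq_one_iff ℚ K g).mp h1)
  obtain ⟨hcc, hcvbar, hcv, hplaces⟩ := eq_or_eq_smul_of_natCast_mem hK.1 hc hp hv hvbar hne
  obtain ⟨Λ, hΛ⟩ := exists_idelicCharacter κ.toContinuousMonoidHom
  have hunit : ∀ u : HeightOneSpectrum (𝓞 K), u ≠ vbar → ∀ y : (u.adicCompletion K)ˣ,
      Valued.v (y : u.adicCompletion K) = 1 → Λ (localUnits u y) = 1 := by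
    intro u hu y hy
    by_cases hpu : ((p : ℕ) : 𝓞 K) ∈ u.asIdeal
    · exact idelicCharacter_localUnits_eq_one_of_inertia_le κ hΛ (hκ u hu) y hy
    · obtain ⟨y', rfl⟩ := IdelicCharacter.exists_unitsMap_eq_of_valued_eq_one y hy
      exact idelicCharacter_localUnits_integer κ hΛ hpu y'
  obtain ⟨h, hh, β, hβ0, hβ⟩ := exists_pow_asIdeal_eq_span (K := K) w
  have hβK : (β : K) ≠ 0 := fun h0 ↦ hβ0 (RingOfIntegers.coe_eq_zero_iff.1 h0)
  set βK : Kˣ := Units.mk0 (β : K) hβK with hβKdef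
  haveI : Finite (placesAbove K p) := finite_placesAbove
  haveI : Fintype (placesAbove K p) := Fintype.ofFinite _
  set S : Finset (HeightOneSpectrum (𝓞 K)) :=
    Finset.univ.image (fun u : placesAbove K p ↦ (u.1 : HeightOneSpectrum (𝓞 K))) with hSdef
  have hS : ∀ u : HeightOneSpectrum (𝓞 K), u ∈ S ↔ (p : 𝓞 K) ∈ u.asIdeal := by
    intro u
    rw [hSdef, Finset.mem_image]
    exact ⟨fun ⟨u', _, h⟩ ↦ h ▸ u'.2, fun hu ↦ ⟨⟨u, hu⟩, Finset.mem_univ _, rfl⟩⟩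
  have hβval : ∀ u : HeightOneSpectrum (𝓞 K), u ≠ w →
      Valued.v ((globalToLocalUnits u βK : (u.adicCompletion K)ˣ) : u.adicCompletion K) = 1 := by
    intro u hu
    rw [val_globalToLocalUnits, Literature.NumberTheory.GaloisRepresentations.valued_algebraMap_adicCompletion, hβKdef,
      Units.val_mk0]
    exact valuation_eq_one_of_pow_asIdeal_eq_span hβ hu
  have hΛβ : Λ (localUnits vbar (globalToLocalUnits vbar βK)) = 1 := by
    have hout : ∀ u ∉ insert w S, u.valuation K (βK : K) = 1 := by
      intro u hu
      rw [Finset.mem_insert, not_or] at hu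
      rw [hβKdef, Units.val_mk0]
      exact valuation_eq_one_of_pow_asIdeal_eq_span hβ hu.1
    have h1 := idelicCharacter_prod_localUnits_eq_one κ hΛ (insert w S)
      (fun u hu ↦ Finset.mem_insert_of_mem ((hS u).mpr hu)) βK hout
    rw [Finset.prod_eq_single_of_mem vbar (Finset.mem_insert_of_mem ((hS vbar).mpr hvbar))] at h1
    · exact h1
    · intro u hu huv
      by_cases huw : u = w
      · rw [huw]
        exact idelicCharacter_localUnits_eq_one_of_decomp_le κ hΛ hD _
      · exact hunit u huv _ (hβval u huw)
  let cU : LocalUnits K p → ∀ u : HeightOneSpectrum (𝓞 K), (u.adicCompletion K)ˣ := fun x u ↦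
    if hu : (p : 𝓞 K) ∈ u.asIdeal then
      Units.map ((u.adicCompletionIntegers K).subtype : _ →* _) (x ⟨u, hu⟩) else 1
  have hcU_mem : ∀ (x : LocalUnits K p) {u : HeightOneSpectrum (𝓞 K)} (hu : (p : 𝓞 K) ∈ u.asIdeal),
      cU x u = Units.map ((u.adicCompletionIntegers K).subtype : _ →* _) (x ⟨u, hu⟩) :=
    fun x u hu ↦ dif_pos hu
  have hcU_not : ∀ (x : LocalUnits K p) {u : HeightOneSpectrum (𝓞 K)}, (p : 𝓞 K) ∉ u.asIdeal →
      cU x u = 1 := fun x u hu ↦ dif_neg hu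
  let ι : LocalUnits K p →* ideleGroup K :=
    { toFun := fun x ↦ ∏ u ∈ S, localUnits u (cU x u)
      map_one' := Finset.prod_eq_one fun u _ ↦ by
        by_cases hu : (p : 𝓞 K) ∈ u.asIdeal
        · rw [hcU_mem 1 hu, Pi.one_apply, map_one, map_one]
        · rw [hcU_not 1 hu, map_one]
      map_mul' := fun x x' ↦ by
        rw [← Finset.prod_mul_distrib]
        refine Finset.prod_congr rfl fun u _ ↦ ?_
        rw [← map_mul]
        by_cases hu : (p : 𝓞 K) ∈ u.asIdeal
        · rw [hcU_mem _ hu, hcU_mem _ hu, hcU_mem _ hu, Pi.mul_apply, map_mul]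
        · rw [hcU_not _ hu, hcU_not _ hu, hcU_not _ hu, mul_one] }
  have hι : ∀ x, ι x = ∏ u ∈ S, localUnits u (cU x u) := fun x ↦ rfl
  have hι_single : ∀ (u : HeightOneSpectrum (𝓞 K)) (hu : (p : 𝓞 K) ∈ u.asIdeal)
      (x : (u.adicCompletionIntegers K)ˣ),
      ι (Pi.mulSingle (⟨u, hu⟩ : placesAbove K p) x) =
        localUnits u (Units.map ((u.adicCompletionIntegers K).subtype : _ →* _) x) := by
    intro u hu x
    rw [hι, Finset.prod_eq_single_of_mem u ((hS u).mpr hu)]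
    · rw [hcU_mem _ hu, Pi.mulSingle_eq_same]
    · intro u' hu' hne'
      rw [hcU_mem _ ((hS u').mp hu'), Pi.mulSingle_eq_of_ne (fun heq ↦ hne' (congrArg Subtype.val heq)),
        map_one, map_one]
  have hsmul_unit : ∀ (u : HeightOneSpectrum (𝓞 K)) (y : (u.adicCompletion K)ˣ), c • u ≠ vbar →
      Valued.v (y : u.adicCompletion K) = 1 → Λ (c • localUnits u y) = 1 := by
    intro u y hcu hy
    rw [algEquiv_smul_localUnits]
    exact hunit (c • u) hcu _ (by rw [valued_galAdicCompletionUnitsEquiv]; exact hy)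
  set l₁ : LocalUnits K p →* Multiplicative ℤ_[p] := Λ.toMonoidHom.comp ι with hl₁
  set l₂ : LocalUnits K p →* Multiplicative ℤ_[p] :=
    Λ.toMonoidHom.comp ((MulDistribMulAction.toMonoidHom (ideleGroup K) c).comp ι) with hl₂
  have hl₁_apply : ∀ x, l₁ x = Λ (ι x) := fun x ↦ rfl
  have hl₂_apply : ∀ x, l₂ x = Λ (c • ι x) := fun x ↦ rfl
  have hkey : ¬ ∀ y : (vbar.adicCompletionIntegers K)ˣ,
      Λ (localUnits vbar (Units.map ((vbar.adicCompletionIntegers K).subtype : _ →* _) y)) = 1 := by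
    intro hall
    obtain ⟨u, hu, y, hne'⟩ := exists_idelicCharacter_localUnits_ne_one κ hΛ
    exact (hplaces u hu).elim (fun h ↦ hne' (h ▸ idelicCharacter_unitsMap_eq_one_of_inertia_le κ hΛ (hκ _ (h ▸ hne.symm)) y))
      fun h ↦ hne' (by subst h; exact hall y)
  have hval1 : ∀ (u : HeightOneSpectrum (𝓞 K)) (y : (u.adicCompletionIntegers K)ˣ),
      Valued.v ((Units.map ((u.adicCompletionIntegers K).subtype : _ →* _) y : (u.adicCompletion K)ˣ) :
        u.adicCompletion K) = 1 := fun u y ↦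
    (Valuation.Integers.isUnit_iff_valuation_eq_one (Valuation.valuationSubring.integers _)).1 (Units.isUnit y)
  have hind : ∀ a b : ℤ_[p], (∀ x : LocalUnits K p, a * (l₁ x).toAdd + b * (l₂ x).toAdd = 0) →
      a = 0 ∧ b = 0 := by
    intro a b hab
    have ha : a = 0 := by
      by_contra ha
      apply hkey
      intro y
      have h1 := hab (Pi.mulSingle (⟨vbar, hvbar⟩ : placesAbove K p) y)
      have h2 : Λ (c • localUnits vbar (Units.map ((vbar.adicCompletionIntegers K).subtype : _ →* _) y)) = 1 :=
        hsmul_unit vbar _ (by rw [hcvbar]; exact hne.symm) (hval1 vbar y)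
      rw [hl₁_apply, hl₂_apply, hι_single vbar hvbar y, h2, toAdd_one, mul_zero, add_zero, mul_eq_zero] at h1
      exact toAdd_eq_zero.mp (h1.resolve_left ha)
    refine ⟨ha, ?_⟩
    by_contra hb
    subst hcv
    apply hkey
    intro y
    set z : ((c • v).adicCompletion K)ˣ := Units.map (((c • v).adicCompletionIntegers K).subtype : _ →* _) y with hz
    have hzv : Valued.v (z : (c • v).adicCompletion K) = 1 := hval1 (c • v) y
    set y₀ : (v.adicCompletion K)ˣ := (galAdicCompletionUnitsEquiv (L := K) c (rfl : c • v = c • v)).symm z with hy₀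
    have hyz : galAdicCompletionUnitsEquiv (L := K) c (rfl : c • v = c • v) y₀ = z := by
      rw [hy₀, MulEquiv.apply_symm_apply]
    have hyv : Valued.v (y₀ : v.adicCompletion K) = 1 := by
      rw [← valued_galAdicCompletionUnitsEquiv (L := K) c (rfl : c • v = c • v) y₀, hyz]; exact hzv
    obtain ⟨y', hy'⟩ := IdelicCharacter.exists_unitsMap_eq_of_valued_eq_one y₀ hyv
    have h1 := hab (Pi.mulSingle (⟨v, hv⟩ : placesAbove K p) y')
    rw [ha, zero_mul, zero_add, hl₂_apply, hι_single v hv y', hy', algEquiv_smul_localUnits, hyz,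
      mul_eq_zero] at h1
    exact toAdd_eq_zero.mp (h1.resolve_left hb)
  have hScases : ∀ u ∈ S, u = v ∨ u = vbar := fun u hu ↦ hplaces u ((hS u).mp hu)
  let e : HeightOneSpectrum (𝓞 K) → Kˣ := fun u ↦ if u = vbar then βK else c • βK
  have he_vbar : e vbar = βK := if_pos rfl
  have he_v : e v = c • βK := if_neg hne.symm
  have hcw : c • w ≠ v := by
    intro h1
    apply hw
    have h2 := congrArg (fun x ↦ c • x) h1
    simp only [smul_smul, hcc, one_smul] at h2
    rw [h2, hcv]
  have heval : ∀ u ∈ S, Valued.v ((globalToLocalUnits u (e u) : (u.adicCompletion K)ˣ) : u.adicCompletion K) = 1 := by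
    intro u hu
    rcases hScases u hu with rfl | rfl
    · -- at `v`: `c β` generates `(c w)^h` and `c w ≠ v`
      rw [he_v, val_globalToLocalUnits, Literature.NumberTheory.GaloisRepresentations.valued_algebraMap_adicCompletion]
      have h3 := HeightOneSpectrum.valuation_algEquiv_smul (F := ℚ) c (c⁻¹ • u) (βK : K)
      rw [smul_inv_smul] at h3
      change u.valuation K (c (βK : K)) = 1
      rw [h3, hβKdef, Units.val_mk0]
      refine valuation_eq_one_of_pow_asIdeal_eq_span hβ fun h' ↦ hcw ?_
      rw [← h', smul_inv_smul]
    · rw [he_vbar]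
      exact hβval _ hw.symm
  choose yU hyU using fun u : placesAbove K p ↦
    IdelicCharacter.exists_unitsMap_eq_of_valued_eq_one (globalToLocalUnits u.1 (e u.1)) (heval u.1 ((hS u.1).mpr u.2))
  have hιy : ι yU = ∏ u ∈ S, localUnits u (globalToLocalUnits u (e u)) := by
    rw [hι]
    refine Finset.prod_congr rfl fun u hu ↦ ?_
    rw [hcU_mem yU ((hS u).mp hu), hyU ⟨u, _⟩]
  have hcS : ∀ u, u ∈ S ↔ c • u ∈ S := by
    intro u
    rw [hS, hS]
    have h1 := HeightOneSpectrum.smul_mem_smul_asIdeal_iff c u ((p : ℕ) : 𝓞 K)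
    rw [show c • ((p : ℕ) : 𝓞 K) = (p : 𝓞 K) from map_natCast (MulSemiringAction.toRingHom _ _ c) p] at h1
    exact h1.symm
  have hce : ∀ u ∈ S, c • e u = e (c • u) := by
    intro u hu
    rcases hScases u hu with rfl | rfl
    · rw [he_v, hcv, he_vbar, smul_smul, hcc, one_smul]
    · rw [he_vbar, hcvbar, he_v]
  have hcιy : c • ι yU = ι yU := by
    rw [hιy, Finset.smul_prod']
    have h1 : ∀ u ∈ S, c • localUnits u (globalToLocalUnits u (e u)) =
        localUnits (c • u) (globalToLocalUnits (c • u) (e (c • u))) := by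
      intro u hu
      have h := algEquiv_smul_localUnits_unitsToCompletion ℚ K c u (e u)
      rw [hce u hu] at h
      exact h
    rw [Finset.prod_congr rfl h1]
    exact Finset.prod_nbij (fun u ↦ c • u) (fun u hu ↦ (hcS u).mp hu)
      (fun u₁ _ u₂ _ h ↦ smul_left_cancel c h)
      (fun u hu ↦ ⟨c⁻¹ • u, (hcS _).mpr (by rw [smul_inv_smul]; exact hu), smul_inv_smul c u⟩)
      (fun u _ ↦ rfl)
  have hl₁y : l₁ yU = 1 := by
    rw [hl₁_apply, hιy, map_prod]
    refine Finset.prod_eq_one fun u hu ↦ ?_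
    rcases hScases u hu with rfl | rfl
    · exact hunit u hne.symm _ (heval u hu)
    · rw [he_vbar]; exact hΛβ
  have hl₂y : l₂ yU = 1 := by
    rw [hl₂_apply, hcιy]
    exact hl₁y
  obtain ⟨W, -, hWfi, ⟨eW⟩⟩ := exists_openSubgroup_localUnits_equiv_holds K p
  haveI := hWfi
  rw [hK.1] at eW
  have hpow : yU ^ W.index = 1 := pow_index_eq_one_of_apply_eq_one W eW.toMulEquiv l₁ l₂ hind hl₁y hl₂y
  have hm0 : W.index ≠ 0 := Subgroup.FiniteIndex.index_ne_zero
  have hβm : ((β : K) ^ W.index : K) = 1 := by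
    have h1 := congrArg (fun x : LocalUnits K p ↦ ((Units.map ((vbar.adicCompletionIntegers K).subtype : _ →* _)
      (x ⟨vbar, hvbar⟩) : (vbar.adicCompletion K)ˣ) : vbar.adicCompletion K)) hpow
    simp only [Pi.pow_apply, map_pow, Units.val_pow_eq_pow_val, Pi.one_apply, map_one, Units.val_one] at h1
    rw [hyU ⟨vbar, hvbar⟩, he_vbar, val_globalToLocalUnits, ← map_pow,
      ← map_one (algebraMap K (vbar.adicCompletion K))] at h1
    have h2 := (algebraMap K (vbar.adicCompletion K)).injective h1
    rw [hβKdef, Units.val_mk0] at h2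
    exact h2
  have hβunit : IsUnit β := by
    have h1 : β ^ W.index = 1 := by
      apply RingOfIntegers.coe_injective
      push_cast
      exact hβm
    exact IsUnit.of_pow_eq_one h1 hm0
  have htop : w.asIdeal ^ h = ⊤ := by rw [hβ, Ideal.span_singleton_eq_top]; exact hβunit
  have hle : w.asIdeal ^ h ≤ w.asIdeal := Ideal.pow_le_self hh
  exact w.isPrime.ne_top (top_le_iff.mp (htop ▸ hle))

end Main

end Summit.BirchSwinnertonDyer.BirchSwinnertonDyer.Theorems.PrintCf2.LineDecomposition

end
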